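import Mathlib.Data.Nat.Log
import Literature.Computability.Complexity.MapFstMachine
import Literature.Computability.Complexity.NSUBEXPGuardedBall
import Literature.Computability.Complexity.Classes
import Literature.Computability.Complexity.TimeBoundsProofs
import HarnessLib

/-!
# Route UniformStream, crux `UniformMagnification` (stmt-PneNP-16047), line `registered`,
# stub `stub_padAssembly`: the padded update / accept machines

**Theorem** (`stub_padAssembly`). Let `δ ∈ FP` be non-lengthening on state words
(`|δ ⟨st, [b]⟩| ≤ |st|`) and `α ∈ P`. Assume (hypothesis `hcore`, the statement of the stage-A
stub) that for every guard constant `k` two linear-time `TM2` machines `MA`, `MA'` re-parse a state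
word `ST = st·st ++ x y ++ rest` (`st` doubled bit by bit up to the first unequal pair `x ≠ y`),
evaluate the guard `k (⌊log₂(|st|+1)⌋ + 1) ≤ ⌊log₂(|rest|+1)⌋` and emit
`⟨1 · ⟨st, [b]⟩ | 0 0, 1^{|rest|}⟩` (from `⟨ST, b⟩`), resp. `1 · st | 0 0` (from `ST`), a state
word without unequal pair being answered `⟨0 0, ε⟩`, resp. `0 0`. Then there are `k`, `C`, total
maps `U`, `acc` and two machines `M₁`, `M₂` with: `M₁` computes `U ST b` from `⟨ST, b⟩` within
`C |ST| + C` steps, `|U ST b| ≤ max |ST| 2`, and on an adequately padded state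
`ST = ⟨st, 1ᵀ⟩` (`k (⌊log₂(|st|+1)⌋ + 1) ≤ ⌊log₂(T+1)⌋`) `U ST b = ⟨δ ⟨st, [b]⟩, 1ᵀ⟩`; `M₂` computes
the bit `acc ST` within `C |ST| + C` steps, and on an adequately padded state `acc ST = 1 ↔ st ∈ α`.

Proof. Let `M_δ` compute `δ` in time `≤ a |w|^e + a` and `M_α` decide `α` in time
`≤ a' |w|^{e'} + a'` (`exists_eval_le_mul_pow_add`, unfolding of `P`). Take `k = e + e' + 1` and
the stage-A machines `MA`, `MA'` of `hcore k`; put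
`M₁ = MA ; mapFstAux (flagAux M_δ (fun _ ↦ ε))` and `M₂ = MA' ; flagAux M_α (fun _ ↦ [0])`
(`Turing.TM2ComputableAux.comp_outputsWithin`, `outputsWithin_mapFstAux`,
`flagAux_outputsWithin_run/_answer`): the flag `1` runs `M_δ` on `⟨st, [b]⟩` (resp. `M_α` on
`st`) while the padding `1^{|rest|}` is parked, the flag `0` answers `ε` (resp. `0`) at once.
Every word `ST` has exactly one of the two stage-A shapes (`PadAssembly.shape_cases`), and on it
`(boolUnpair ST).1 = st`, `readRest ST = rest` (resp. `ε`), which defines the total maps `U`, `acc`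
explicitly. Under the guard, `(|st|+1)^k ≤ 2^{k(⌊log₂(|st|+1)⌋+1)} ≤ 2^{⌊log₂(|rest|+1)⌋} ≤ |rest|+1`
(`Nat.lt_pow_succ_log_self`, `Nat.pow_log_le_self`), so the inner machines run in time linear in
`|rest| ≤ |ST|`, and the whole is linear. A padded state `⟨st, 1ᵀ⟩ = st·st ++ 0 1 ++ 1ᵀ` has the
first shape with `rest = 1ᵀ`.

References: S. Arora, B. Barak, *Computational Complexity: A Modern Approach*, CUP 2009, §1.3
(Claim 1.6; Thm. 2.8 for the pair plumbing); D. M. McKay, C. D. Murray, R. R. Williams, *Weak lower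
bounds on resource-bounded compression imply strong separations of complexity classes*, STOC 2019, §4.
-/

namespace Summit.PneNP.PneNP.Cruxes.UniformMagnification.Birth

set_option linter.dupNamespace false -- `Summit.PneNP.PneNP.…`: summit = sub-problem (D-0017)

open _root_.Computability Literature.Computability.Complexity PairFstTM

namespace PadAssembly

/-! ### The two shapes of a state word -/

/-- Every word is a doubled prefix `st·st` followed either by an unequal pair `x y` and a rest, or
by at most one more symbol. [folklore] -/
theorem shape_cases : ∀ ST : List Bool,
    (∃ (st rest : List Bool) (x y : Bool), x ≠ y ∧
        ST = st.flatMap (fun c => [c, c]) ++ x :: y :: rest) ∨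
      (∃ (st tl : List Bool), tl.length ≤ 1 ∧ ST = st.flatMap (fun c => [c, c]) ++ tl)
  | [] => Or.inr ⟨[], [], Nat.zero_le _, rfl⟩
  | [c] => Or.inr ⟨[], [c], le_rfl, rfl⟩
  | c :: c' :: w => by
    by_cases h : c = c'
    · subst h
      rcases shape_cases w with ⟨st, rest, x, y, hxy, rfl⟩ | ⟨st, tl, htl, rfl⟩
      · exact Or.inl ⟨c :: st, rest, x, y, hxy, rfl⟩
      · exact Or.inr ⟨c :: st, tl, htl, rfl⟩
    · exact Or.inl ⟨[], w, c, c', h, rfl⟩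

/-- The pair decoder reads the doubled prefix up to the first unequal pair. [folklore] -/
theorem boolUnpair_fst_sep (st rest : List Bool) {x y : Bool} (hxy : x ≠ y) :
    (boolUnpair (st.flatMap (fun c => [c, c]) ++ x :: y :: rest)).1 = st := by
  induction st with
  | nil => simp [boolUnpair_fst_cons_cons, hxy]
  | cons c st ih => simpa [boolUnpair_fst_cons_cons] using ih

/-- The pair reader leaves exactly the rest after the first unequal pair. [folklore] -/
theorem readRest_sep (st rest : List Bool) {x y : Bool} (hxy : x ≠ y) :
    readRest (st.flatMap (fun c => [c, c]) ++ x :: y :: rest) = rest := by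
  induction st with
  | nil => simp [readRest, hxy]
  | cons c st ih => simpa [readRest] using ih

/-- Without an unequal pair the pair reader leaves nothing. [folklore] -/
theorem readRest_short (st tl : List Bool) (htl : tl.length ≤ 1) :
    readRest (st.flatMap (fun c => [c, c]) ++ tl) = [] := by
  induction st with
  | nil =>
    rcases tl with _ | ⟨c, _ | ⟨d, tl⟩⟩
    · rfl
    · rfl
    · simp at htl
  | cons c st ih => simpa [readRest] using ih

/-- Length of a word of the first shape: `|st·st ++ x y ++ rest| = 2|st| + 2 + |rest|`. [folklore] -/
theorem length_sep (st rest : List Bool) (x y : Bool) :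
    (st.flatMap (fun c => [c, c]) ++ x :: y :: rest).length = 2 * st.length + 2 + rest.length := by
  rw [List.length_append, MapFstTM.length_flatMap_pair, List.length_cons, List.length_cons]
  omega

/-- Length of a word of the second shape: `|st·st ++ tl| = 2|st| + |tl|`. [folklore] -/
theorem length_short (st tl : List Bool) :
    (st.flatMap (fun c => [c, c]) ++ tl).length = 2 * st.length + tl.length := by
  rw [List.length_append, MapFstTM.length_flatMap_pair]

/-! ### Arithmetic of the guard -/

/-- The guard `k (⌊log₂(m+1)⌋ + 1) ≤ ⌊log₂(T+1)⌋` gives `(m+1)^k ≤ T+1`. [folklore] -/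
theorem succ_pow_le_of_guard {k m T : ℕ} (h : k * (Nat.log 2 (m + 1) + 1) ≤ Nat.log 2 (T + 1)) :
    (m + 1) ^ k ≤ T + 1 :=
  calc (m + 1) ^ k ≤ (2 ^ (Nat.log 2 (m + 1) + 1)) ^ k :=
        Nat.pow_le_pow_left (Nat.lt_pow_succ_log_self one_lt_two _).le k
    _ = 2 ^ (k * (Nat.log 2 (m + 1) + 1)) := by rw [← pow_mul, mul_comm]
    _ ≤ 2 ^ Nat.log 2 (T + 1) := Nat.pow_le_pow_right two_pos h
    _ ≤ T + 1 := Nat.pow_log_le_self 2 (Nat.succ_ne_zero T)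

/-- Under `(m+1)^k ≤ r+1` and `e ≤ k`: `(2m+3)^e ≤ 3^e (r+1)`. [folklore] -/
theorem pair_pow_le {e k m r : ℕ} (he : e ≤ k) (hk : (m + 1) ^ k ≤ r + 1) :
    (2 * m + 3) ^ e ≤ 3 ^ e * (r + 1) :=
  calc (2 * m + 3) ^ e ≤ (3 * (m + 1)) ^ e := Nat.pow_le_pow_left (by omega) e
    _ = 3 ^ e * (m + 1) ^ e := mul_pow 3 (m + 1) e
    _ ≤ 3 ^ e * (m + 1) ^ k := Nat.mul_le_mul_left _ (Nat.pow_le_pow_right (Nat.succ_pos m) he)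
    _ ≤ 3 ^ e * (r + 1) := Nat.mul_le_mul_left _ hk

/-- Under `(m+1)^k ≤ r+1` and `e ≤ k`: `m^e ≤ r+1`. [folklore] -/
theorem pow_le {e k m r : ℕ} (he : e ≤ k) (hk : (m + 1) ^ k ≤ r + 1) : m ^ e ≤ r + 1 :=
  (Nat.pow_le_pow_left (Nat.le_succ m) e).trans ((Nat.pow_le_pow_right (Nat.succ_pos m) he).trans hk)

/-- With `k ≥ 1` the guard fails when nothing is left after the prefix. [folklore] -/
theorem not_guard_nil {k L : ℕ} (hk : 1 ≤ k) :
    ¬ k * (Nat.log 2 (L + 1) + 1) ≤ Nat.log 2 (([] : List Bool).length + 1) := by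
  rw [List.length_nil, Nat.zero_add, Nat.log_one_right]
  intro h
  rcases Nat.mul_eq_zero.1 (Nat.le_zero.1 h) with h0 | h0 <;> omega

/-- Slack in a linear bound. [folklore] -/
theorem lin_mono {B B' L : ℕ} (h : B ≤ B') : B * L + B ≤ B' * L + B' := by gcongr

/-- Time bookkeeping of `M₁`, guard passed. [folklore] -/
theorem arith_run₁ {P Q a C₀ m r d zl : ℕ} (hP : P ≤ Q * (r + 1)) (hd : d ≤ m)
    (hzl : zl = 4 * m + 10 + r) :
    a * P + a + 1 + 3 * d + 2 * zl + 6 + (C₀ * (2 * m + r) + C₀) ≤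
      (C₀ + a * Q + a + 27) * (2 * m + 2 + r) + (C₀ + a * Q + a + 27) := by
  subst hzl
  nlinarith [Nat.mul_le_mul_left a hP, hd, Nat.zero_le (a * Q * m), Nat.zero_le (a * Q),
    Nat.zero_le (a * m), Nat.zero_le (a * r), Nat.zero_le (C₀ * m)]

/-- Time bookkeeping of `M₁`, guard failed. [folklore] -/
theorem arith_skip₁ {Q a C₀ m r d zl : ℕ} (hd : d = 0) (hzl : zl = 6 + r) :
    2 + 3 * d + 2 * zl + 6 + (C₀ * (2 * m + r) + C₀) ≤
      (C₀ + a * Q + a + 27) * (2 * m + 2 + r) + (C₀ + a * Q + a + 27) := by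
  subst hd hzl
  nlinarith [Nat.zero_le (C₀ * m), Nat.zero_le (C₀ * r), Nat.zero_le (a * Q * m),
    Nat.zero_le (a * Q * r), Nat.zero_le (a * Q), Nat.zero_le (a * m), Nat.zero_le (a * r)]

/-- Time bookkeeping of `M₁`, malformed state. [folklore] -/
theorem arith_bad₁ {Q a C₀ m t d zl : ℕ} (hd : d = 0) (hzl : zl = 6) :
    2 + 3 * d + 2 * zl + 6 + (C₀ * m + C₀) ≤
      (C₀ + a * Q + a + 27) * (2 * m + t) + (C₀ + a * Q + a + 27) := by
  subst hd hzl
  nlinarith [Nat.zero_le (C₀ * m), Nat.zero_le (C₀ * t), Nat.zero_le (a * Q * m),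
    Nat.zero_le (a * Q * t), Nat.zero_le (a * Q), Nat.zero_le (a * m), Nat.zero_le (a * t)]

/-- Time bookkeeping of `M₂`, guard passed. [folklore] -/
theorem arith_run₂ {P a C₀ m r : ℕ} (hP : P ≤ r + 1) :
    a * P + a + 1 + (C₀ * (2 * m + r) + C₀) ≤ (C₀ + a + 2) * (2 * m + 2 + r) + (C₀ + a + 2) := by
  nlinarith [Nat.mul_le_mul_left a hP, Nat.zero_le (a * m), Nat.zero_le (C₀ * m), Nat.zero_le (C₀ * r)]

/-- Time bookkeeping of `M₂`, guard failed. [folklore] -/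
theorem arith_skip₂ {a C₀ m r : ℕ} :
    2 + (C₀ * (2 * m + r) + C₀) ≤ (C₀ + a + 2) * (2 * m + 2 + r) + (C₀ + a + 2) := by
  nlinarith [Nat.zero_le (a * m), Nat.zero_le (a * r), Nat.zero_le (C₀ * m), Nat.zero_le (C₀ * r)]

/-- Time bookkeeping of `M₂`, malformed state. [folklore] -/
theorem arith_bad₂ {a C₀ m t : ℕ} :
    2 + (C₀ * m + C₀) ≤ (C₀ + a + 2) * (2 * m + t) + (C₀ + a + 2) := by
  nlinarith [Nat.zero_le (a * m), Nat.zero_le (a * t), Nat.zero_le (C₀ * m), Nat.zero_le (C₀ * t)]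

/-! ### The update machine `M₁ = MA ; mapFstAux (flagAux M_δ ε)` -/

/-- **The padded update machine.** With the stage-A machine `MA` for the guard constant `k ≥ e, 1`
and a machine `M_δ` for `δ` of time `a |w|^e + a`, the composite
`MA ; mapFstAux (flagAux M_δ (fun _ ↦ ε))` maps `⟨ST, b⟩` to the explicit update word within
`B |ST| + B` steps, `B = C₀ + a 3^e + a + 27`. [cite: AroraBarakCC2009, §1.3 (Claim 1.6)] -/
theorem outputsWithin_padU {k C₀ a e : ℕ} (hek : e ≤ k) (hk : 1 ≤ k) {δ : List Bool → List Bool}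
    (hle : ∀ (st : List Bool) (b : Bool), (δ (boolPair st [b])).length ≤ st.length)
    {Mδ MA : Turing.TM2ComputableAux Bool Bool}
    (hMδ : ∀ w : List Bool, Mδ.OutputsWithin w (δ w) (a * w.length ^ e + a))
    (hA1 : ∀ (st rest : List Bool) (x y b : Bool), x ≠ y →
        MA.OutputsWithin (boolPair (st.flatMap (fun c => [c, c]) ++ x :: y :: rest) [b])
          (boolPair (if k * (Nat.log 2 (st.length + 1) + 1) ≤ Nat.log 2 (rest.length + 1)
              then true :: boolPair st [b] else [false, false])
            (List.replicate rest.length true))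
          (C₀ * (2 * st.length + rest.length) + C₀))
    (hA2 : ∀ (st tl : List Bool) (b : Bool), tl.length ≤ 1 →
        MA.OutputsWithin (boolPair (st.flatMap (fun c => [c, c]) ++ tl) [b])
          (boolPair [false, false] []) (C₀ * st.length + C₀))
    (ST : List Bool) (b : Bool) :
    (MA.comp (mapFstAux (flagAux Mδ fun _ => []))).OutputsWithin (boolPair ST [b])
      (if k * (Nat.log 2 ((boolUnpair ST).1.length + 1) + 1) ≤ Nat.log 2 ((readRest ST).length + 1)
        then boolPair (δ (boolPair (boolUnpair ST).1 [b])) (List.replicate (readRest ST).length true)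
        else boolPair [] (List.replicate (readRest ST).length true))
      ((C₀ + a * 3 ^ e + a + 27) * ST.length + (C₀ + a * 3 ^ e + a + 27)) := by
  rcases shape_cases ST with ⟨st, rest, x, y, hxy, rfl⟩ | ⟨st, tl, htl, rfl⟩
  · have hA := hA1 st rest x y b hxy
    rw [boolUnpair_fst_sep st rest hxy, readRest_sep st rest hxy, length_sep]
    by_cases hG : k * (Nat.log 2 (st.length + 1) + 1) ≤ Nat.log 2 (rest.length + 1)
    · -- guard passed: run `M_δ` on `⟨st, [b]⟩`, the padding parked
      rw [if_pos hG] at hA ⊢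
      have h1 : (flagAux Mδ fun _ => []).OutputsWithin
          (boolUnpair (boolPair (true :: boolPair st [b]) (List.replicate rest.length true))).1
          (δ (boolPair st [b])) (a * (2 * st.length + 3) ^ e + a + 1) := by
        rw [boolUnpair_boolPair]
        have h := flagAux_outputsWithin_run Mδ (fun _ => []) (hMδ (boolPair st [b]))
        rw [length_boolPair, List.length_singleton] at h
        exact h
      have h2 := outputsWithin_mapFstAux (flagAux Mδ fun _ => []) h1
      rw [readRest_boolPair] at h2
      refine (Turing.TM2ComputableAux.comp_outputsWithin _ _ hA h2).mono ?_
      refine arith_run₁ (pair_pow_le hek (succ_pow_le_of_guard hG)) (hle st b) ?_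
      rw [length_boolPair, List.length_cons, length_boolPair, List.length_singleton,
        List.length_replicate]
      omega
    · -- guard failed: the flag `0` answers `ε`
      rw [if_neg hG] at hA ⊢
      have h1 : (flagAux Mδ fun _ => []).OutputsWithin
          (boolUnpair (boolPair [false, false] (List.replicate rest.length true))).1 [] 2 := by
        rw [boolUnpair_boolPair]
        exact flagAux_outputsWithin_answer Mδ (fun _ => []) false
      have h2 := outputsWithin_mapFstAux (flagAux Mδ fun _ => []) h1
      rw [readRest_boolPair] at h2
      refine (Turing.TM2ComputableAux.comp_outputsWithin _ _ hA h2).mono ?_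
      exact arith_skip₁ List.length_nil
        (by simp only [length_boolPair, List.length_cons, List.length_nil, List.length_replicate])
  · -- malformed state: `MA` answers `⟨0 0, ε⟩`, the flag `0` answers `ε`
    have hA := hA2 st tl b htl
    rw [readRest_short st tl htl, if_neg (not_guard_nil hk), length_short]
    have h1 : (flagAux Mδ fun _ => []).OutputsWithin
        (boolUnpair (boolPair [false, false] [])).1 [] 2 := by
      rw [boolUnpair_boolPair]
      exact flagAux_outputsWithin_answer Mδ (fun _ => []) false
    have h2 := outputsWithin_mapFstAux (flagAux Mδ fun _ => []) h1
    rw [readRest_boolPair] at h2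
    refine (Turing.TM2ComputableAux.comp_outputsWithin _ _ hA h2).mono ?_
    exact arith_bad₁ List.length_nil
      (by simp only [length_boolPair, List.length_cons, List.length_nil])

/-- **The update word is never longer than the state** (or than `2`). [folklore] -/
theorem length_padU_le {k : ℕ} (hk : 1 ≤ k) {δ : List Bool → List Bool}
    (hle : ∀ (st : List Bool) (b : Bool), (δ (boolPair st [b])).length ≤ st.length)
    (ST : List Bool) (b : Bool) :
    (if k * (Nat.log 2 ((boolUnpair ST).1.length + 1) + 1) ≤ Nat.log 2 ((readRest ST).length + 1)
        then boolPair (δ (boolPair (boolUnpair ST).1 [b])) (List.replicate (readRest ST).length true)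
        else boolPair [] (List.replicate (readRest ST).length true)).length ≤ max ST.length 2 := by
  rcases shape_cases ST with ⟨st, rest, x, y, hxy, rfl⟩ | ⟨st, tl, htl, rfl⟩
  · rw [boolUnpair_fst_sep st rest hxy, readRest_sep st rest hxy, length_sep]
    refine le_max_of_le_left ?_
    have h := hle st b
    split_ifs <;> simp only [length_boolPair, List.length_replicate, List.length_nil] <;> omega
  · rw [readRest_short st tl htl, if_neg (not_guard_nil hk)]
    exact le_max_right _ _

/-! ### The accept machine `M₂ = MA' ; flagAux M_α 0` -/

/-- **The padded accept machine.** With the stage-A machine `MA'` for the guard constant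
`k ≥ e, 1` and a decider `M_α` of `α` of time `a |w|^e + a`, the composite
`MA' ; flagAux M_α (fun _ ↦ [0])` maps `ST` to the explicit accept bit within `B |ST| + B` steps,
`B = C₀ + a + 2`. [cite: AroraBarakCC2009, §1.3 (Claim 1.6)] -/
theorem outputsWithin_padAcc {k C₀ a e : ℕ} (hek : e ≤ k) (hk : 1 ≤ k) (α : Language Bool)
    {Mα MA' : Turing.TM2ComputableAux Bool Bool}
    (hMα : ∀ w : List Bool, Mα.OutputsWithin w (encodeBool (α.boolIndicator w)) (a * w.length ^ e + a))
    (hA3 : ∀ (st rest : List Bool) (x y : Bool), x ≠ y →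
        MA'.OutputsWithin (st.flatMap (fun c => [c, c]) ++ x :: y :: rest)
          (if k * (Nat.log 2 (st.length + 1) + 1) ≤ Nat.log 2 (rest.length + 1)
            then true :: st else [false, false])
          (C₀ * (2 * st.length + rest.length) + C₀))
    (hA4 : ∀ (st tl : List Bool), tl.length ≤ 1 →
        MA'.OutputsWithin (st.flatMap (fun c => [c, c]) ++ tl) [false, false] (C₀ * st.length + C₀))
    (ST : List Bool) :
    (MA'.comp (flagAux Mα fun _ => encodeBool false)).OutputsWithin ST
      (encodeBool
        (if k * (Nat.log 2 ((boolUnpair ST).1.length + 1) + 1) ≤ Nat.log 2 ((readRest ST).length + 1)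
          then α.boolIndicator (boolUnpair ST).1 else false))
      ((C₀ + a + 2) * ST.length + (C₀ + a + 2)) := by
  rcases shape_cases ST with ⟨st, rest, x, y, hxy, rfl⟩ | ⟨st, tl, htl, rfl⟩
  · have hA := hA3 st rest x y hxy
    rw [boolUnpair_fst_sep st rest hxy, readRest_sep st rest hxy, length_sep]
    by_cases hG : k * (Nat.log 2 (st.length + 1) + 1) ≤ Nat.log 2 (rest.length + 1)
    · -- guard passed: run `M_α` on `st`
      rw [if_pos hG] at hA ⊢
      have h1 := flagAux_outputsWithin_run Mα (fun _ => encodeBool false) (hMα st)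
      refine (Turing.TM2ComputableAux.comp_outputsWithin _ _ hA h1).mono ?_
      exact arith_run₂ (pow_le hek (succ_pow_le_of_guard hG))
    · -- guard failed: the flag `0` answers `0`
      rw [if_neg hG] at hA ⊢
      have h1 := flagAux_outputsWithin_answer Mα (fun _ => encodeBool false) false
      refine (Turing.TM2ComputableAux.comp_outputsWithin _ _ hA h1).mono ?_
      exact arith_skip₂
  · -- malformed state
    have hA := hA4 st tl htl
    rw [readRest_short st tl htl, if_neg (not_guard_nil hk), length_short]
    have h1 := flagAux_outputsWithin_answer Mα (fun _ => encodeBool false) false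
    refine (Turing.TM2ComputableAux.comp_outputsWithin _ _ hA h1).mono ?_
    exact arith_bad₂

end PadAssembly

/-! ### The stub -/

open PadAssembly in
/-- **stub_padAssembly** — the padded update / accept machines from the stage-A machines: for
`δ ∈ FP` with machine `M_δ` of time `≤ a (|w|)^e + a` (`exists_eval_le_mul_pow_add`) and `α ∈ P`
with decider `M_α` of time `≤ a' |w|^{e'} + a'`, take `k := e + e' + 1` and
`M₁ := MA ; mapFstAux (flagAux M_δ (fun _ ↦ ε))`, `M₂ := MA' ; flagAux M_α (fun _ ↦ [0])`
(`outputsWithin_mapFstAux`, `readRest_boolPair`, `flagAux_outputsWithin_run/_answer`,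
`Turing.TM2ComputableAux.comp_outputsWithin`); every state word has one of the two stage-A
shapes (first unequal pair / none), which defines the total maps `U`, `acc` through
`(boolUnpair ST).1` and `readRest ST`; under the guard `k (⌊log₂(m+1)⌋ + 1) ≤ ⌊log₂(T+1)⌋` one has
`(m+1)^k ≤ T+1` (`Nat.lt_pow_succ_log_self`, `Nat.pow_log_le_self`), so the inner machines run in
time linear in the padding and the whole is linear; `|U ST b| ≤ max |ST| 2` from
`|δ ⟨st, [b]⟩| ≤ |st|` and the shapes. [cite: AroraBarakCC2009, §1.3 (Claim 1.6)] -/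
theorem stub_padAssembly
    (hcore : ∀ k : ℕ, ∃ (C : ℕ) (MA MA' : Turing.TM2ComputableAux Bool Bool),
      (∀ (st rest : List Bool) (x y b : Bool), x ≠ y →
        MA.OutputsWithin (boolPair (st.flatMap (fun c => [c, c]) ++ x :: y :: rest) [b])
          (boolPair (if k * (Nat.log 2 (st.length + 1) + 1) ≤ Nat.log 2 (rest.length + 1)
              then true :: boolPair st [b] else [false, false])
            (List.replicate rest.length true))
          (C * (2 * st.length + rest.length) + C)) ∧
      (∀ (st tl : List Bool) (b : Bool), tl.length ≤ 1 →
        MA.OutputsWithin (boolPair (st.flatMap (fun c => [c, c]) ++ tl) [b]) (boolPair [false, false] [])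
          (C * st.length + C)) ∧
      (∀ (st rest : List Bool) (x y : Bool), x ≠ y →
        MA'.OutputsWithin (st.flatMap (fun c => [c, c]) ++ x :: y :: rest)
          (if k * (Nat.log 2 (st.length + 1) + 1) ≤ Nat.log 2 (rest.length + 1)
            then true :: st else [false, false])
          (C * (2 * st.length + rest.length) + C)) ∧
      (∀ (st tl : List Bool), tl.length ≤ 1 →
        MA'.OutputsWithin (st.flatMap (fun c => [c, c]) ++ tl) [false, false] (C * st.length + C)))
    (δ : List Bool → List Bool) (α : Language Bool) (hδ : δ ∈ FP)
    (hα : α ∈ Classes.P) (hle : ∀ (st : List Bool) (b : Bool), (δ (boolPair st [b])).length ≤ st.length) :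
    ∃ (k C : ℕ) (U : List Bool → Bool → List Bool) (acc : List Bool → Bool)
      (M₁ M₂ : Turing.TM2ComputableAux Bool Bool),
      (∀ (ST : List Bool) (b : Bool), M₁.OutputsWithin (boolPair ST [b]) (U ST b) (C * ST.length + C)) ∧
      (∀ (ST : List Bool) (b : Bool), (U ST b).length ≤ max ST.length 2) ∧
      (∀ (st : List Bool) (T : ℕ) (b : Bool),
          k * (Nat.log 2 (st.length + 1) + 1) ≤ Nat.log 2 (T + 1) →
          U (boolPair st (List.replicate T true)) b =
            boolPair (δ (boolPair st [b])) (List.replicate T true)) ∧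
      (∀ ST : List Bool, M₂.OutputsWithin ST (encodeBool (acc ST)) (C * ST.length + C)) ∧
      (∀ (st : List Bool) (T : ℕ), k * (Nat.log 2 (st.length + 1) + 1) ≤ Nat.log 2 (T + 1) →
          (acc (boolPair st (List.replicate T true)) = true ↔ st ∈ α)) := by
  -- the machine of `δ`, with a monomial time bound `a |w|^e + a`
  obtain ⟨p, Mδ, hMδ⟩ := hδ
  obtain ⟨a, e, hae⟩ := exists_eval_le_mul_pow_add p
  have hMδ' : ∀ w : List Bool, Mδ.OutputsWithin w (δ w) (a * w.length ^ e + a) :=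
    fun w => (hMδ w).mono (hae _)
  -- the decider of `α`, of time `a' |w|^e' + a'`
  simp only [Classes.P, Set.mem_iUnion] at hα
  obtain ⟨e', a', Mα, hMα⟩ := hα
  have hMα' : ∀ w : List Bool,
      Mα.OutputsWithin w (encodeBool (α.boolIndicator w)) (a' * w.length ^ e' + a') :=
    fun w => hMα w
  -- the stage-A machines for the guard constant `k = e + e' + 1`
  obtain ⟨C₀, MA, MA', hA1, hA2, hA3, hA4⟩ := hcore (e + e' + 1)
  refine ⟨e + e' + 1, (C₀ + a * 3 ^ e + a + 27) + (C₀ + a' + 2),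
    fun ST b =>
      if (e + e' + 1) * (Nat.log 2 ((boolUnpair ST).1.length + 1) + 1) ≤
          Nat.log 2 ((readRest ST).length + 1)
        then boolPair (δ (boolPair (boolUnpair ST).1 [b])) (List.replicate (readRest ST).length true)
        else boolPair [] (List.replicate (readRest ST).length true),
    fun ST =>
      if (e + e' + 1) * (Nat.log 2 ((boolUnpair ST).1.length + 1) + 1) ≤
          Nat.log 2 ((readRest ST).length + 1)
        then α.boolIndicator (boolUnpair ST).1 else false,
    MA.comp (mapFstAux (flagAux Mδ fun _ => [])),
    MA'.comp (flagAux Mα fun _ => encodeBool false), ?_, ?_, ?_, ?_, ?_⟩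
  · -- `M₁` computes `U` in linear time
    intro ST b
    exact (outputsWithin_padU (k := e + e' + 1) (by omega) (by omega) hle hMδ' hA1 hA2 ST b).mono
      (lin_mono (Nat.le_add_right _ _))
  · -- `|U ST b| ≤ max |ST| 2`
    intro ST b
    exact length_padU_le (k := e + e' + 1) (by omega) hle ST b
  · -- `U ⟨st, 1ᵀ⟩ b = ⟨δ ⟨st, [b]⟩, 1ᵀ⟩` under the guard
    intro st T b hG
    dsimp only
    rw [boolUnpair_boolPair, readRest_boolPair, List.length_replicate, if_pos hG]
  · -- `M₂` computes `acc` in linear time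
    intro ST
    exact (outputsWithin_padAcc (k := e + e' + 1) (by omega) (by omega) α hMα' hA3 hA4 ST).mono
      (lin_mono (Nat.le_add_left _ _))
  · -- `acc ⟨st, 1ᵀ⟩ = 1 ↔ st ∈ α` under the guard
    intro st T hG
    dsimp only
    rw [boolUnpair_boolPair, readRest_boolPair, List.length_replicate, if_pos hG]
    exact (Set.mem_iff_boolIndicator (s := α) st).symm

end Summit.PneNP.PneNP.Cruxes.UniformMagnification.Birth
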